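import Summits.CriticalPhenomena.PercolationContinuityZ3.Theorems.PercNearOneGluingNoHeavyLowerTailSunflowerOpenProduct

/-!
# `NoHeavyLowerTail` (crux stmt-CriticalPhenomena-4575), abstract sunflower cubic: THE OPEN PRODUCT OF A UNION-CLOSED FAMILY
# Part B — Lazard elimination of a colour (FACT 2) and truncation congruences

Support file (seat `prim-ineq-prove-1` gen 46; `--supports stmt-CriticalPhenomena-4575`).  Continues `…SunflowerOpenProduct`.
Memo: run/shared/lean/prim/prim-ineq-prove-1/FINDING-PAR-prove1-g46.md §1.2.
* `VanLT d φ` (all coefficients of total degree `< d` vanish): an ideal (`VanLT.mul_left`), and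
  `VanLT.mul_of_constantCoeff` (gain one degree against a series without constant term); `Cong1 d w` (a unit is `≡ 1`
  below degree `d`), stable under `*`, `⁻¹`, `^ (e : ℤ)`, `∏`.
* `elim m C` (Lazard elimination of the colour `C`): `(elim m C) S = [S ≠ C]·m S + g·∑ {m T : T ⊆ S, T ≠ C, T ∪ C = S}`,
  `g = (1 - m C)⁻¹ - 1`; `isConfig_elim`; FACT 2: `y_elim_of_not_subset` (`y' B = y B` for `B ⊉ C`),
  `one_sub_y_elim_of_subset` (`1 - y' B = (1 - y B)(1 - m C)⁻¹` for `B ⊇ C`), `T_elim` (`T' S = T S · V^(-[S = C])`) and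
  **`F_elim`**: `F (elim m C) 𝒪 = F m 𝒪` whenever `C ∉ 𝒪` — eliminating a NON-open colour leaves the open product invariant.
-/

namespace Summit.CriticalPhenomena.PercolationContinuityZ3.Theorems.SunflowerPartition

namespace OpenProduct

open MvPowerSeries Finset

variable {A : Type*}

/-! ## Truncation: series vanishing in low degrees -/

/-- `VanLT d φ`: all coefficients of total degree `< d` vanish. [this work] -/
def VanLT (d : ℕ) (φ : MvPowerSeries A ℚ) : Prop := ∀ n : A →₀ ℕ, n.degree < d → coeff n φ = 0

/-- `0` vanishes below every degree. [this work] -/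
theorem VanLT.zero (d : ℕ) : VanLT d (0 : MvPowerSeries A ℚ) := fun n _ => by simp

/-- `VanLT d` is closed under addition. [this work] -/
theorem VanLT.add {d : ℕ} {φ ψ : MvPowerSeries A ℚ} (hφ : VanLT d φ) (hψ : VanLT d ψ) : VanLT d (φ + ψ) :=
  fun n hn => by rw [map_add, hφ n hn, hψ n hn, add_zero]

/-- `VanLT d` is closed under negation. [this work] -/
theorem VanLT.neg {d : ℕ} {φ : MvPowerSeries A ℚ} (hφ : VanLT d φ) : VanLT d (-φ) :=
  fun n hn => by rw [map_neg, hφ n hn, neg_zero]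

/-- `VanLT d` is closed under subtraction. [this work] -/
theorem VanLT.sub {d : ℕ} {φ ψ : MvPowerSeries A ℚ} (hφ : VanLT d φ) (hψ : VanLT d ψ) : VanLT d (φ - ψ) :=
  fun n hn => by rw [map_sub, hφ n hn, hψ n hn, sub_zero]

/-- `VanLT d` is closed under finite sums. [this work] -/
theorem VanLT.sum {d : ℕ} {ι : Type*} (s : Finset ι) (f : ι → MvPowerSeries A ℚ) (h : ∀ i ∈ s, VanLT d (f i)) :
    VanLT d (∑ i ∈ s, f i) :=
  fun n hn => by rw [map_sum]; exact sum_eq_zero fun i hi => h i hi n hn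

/-- Vanishing below `d` implies vanishing below any `d' ≤ d`. [this work] -/
theorem VanLT.mono {d d' : ℕ} (hdd' : d' ≤ d) {φ : MvPowerSeries A ℚ} (hφ : VanLT d φ) : VanLT d' φ :=
  fun n hn => hφ n (lt_of_lt_of_le hn hdd')

variable [DecidableEq A]

/-- On the antidiagonal of `n` the second component has degree `≤ deg n`. [this work] -/
theorem degree_snd_le_of_mem_antidiagonal {n : A →₀ ℕ} {x : (A →₀ ℕ) × (A →₀ ℕ)} (hx : x ∈ antidiagonal n) :
    x.2.degree ≤ n.degree := by
  rw [Finset.HasAntidiagonal.mem_antidiagonal] at hx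
  rw [← hx, map_add]
  exact Nat.le_add_left _ _

/-- On the antidiagonal of `n` the first component has degree `≤ deg n`. [this work] -/
theorem degree_fst_le_of_mem_antidiagonal {n : A →₀ ℕ} {x : (A →₀ ℕ) × (A →₀ ℕ)} (hx : x ∈ antidiagonal n) :
    x.1.degree ≤ n.degree := by
  rw [Finset.HasAntidiagonal.mem_antidiagonal] at hx
  rw [← hx, map_add]
  exact Nat.le_add_right _ _

/-- Low-degree vanishing is an ideal property. [this work] -/
theorem VanLT.mul_left {d : ℕ} {φ : MvPowerSeries A ℚ} (hφ : VanLT d φ) (ψ : MvPowerSeries A ℚ) : VanLT d (ψ * φ) :=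
  fun n hn => by
    rw [coeff_mul]
    exact sum_eq_zero fun x hx => by
      rw [hφ x.2 (lt_of_le_of_lt (degree_snd_le_of_mem_antidiagonal hx) hn), mul_zero]

/-- Low-degree vanishing is an ideal property (right multiplication). [this work] -/
theorem VanLT.mul_right {d : ℕ} {φ : MvPowerSeries A ℚ} (hφ : VanLT d φ) (ψ : MvPowerSeries A ℚ) : VanLT d (φ * ψ) := by
  rw [mul_comm]; exact hφ.mul_left ψ

/-- A product of a series vanishing below `d` and a series without constant term vanishes below `d + 1`. [this work] -/
theorem VanLT.mul_of_constantCoeff {d : ℕ} {φ ψ : MvPowerSeries A ℚ} (hφ : VanLT d φ) (hψ : constantCoeff ψ = 0) :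
    VanLT (d + 1) (φ * ψ) := by
  intro n hn
  rw [coeff_mul]
  refine sum_eq_zero fun x hx => ?_
  by_cases h1 : x.1.degree < d
  · rw [hφ x.1 h1, zero_mul]
  · have hsum : x.1.degree + x.2.degree = n.degree := by
      rw [← map_add, (Finset.HasAntidiagonal.mem_antidiagonal.mp hx)]
    have h2 : x.2.degree = 0 := by omega
    rw [Finsupp.degree_eq_zero_iff] at h2
    rw [h2, coeff_zero_eq_constantCoeff_apply, hψ, mul_zero]

/-! ## Congruence to `1` of units modulo low degrees -/

/-- `Cong1 d w`: the unit `w` is `≡ 1` modulo terms of degree `≥ d`. [this work] -/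
def Cong1 (d : ℕ) (w : (MvPowerSeries A ℚ)ˣ) : Prop := VanLT d ((w : MvPowerSeries A ℚ) - 1)

omit [DecidableEq A] in
/-- `1 ≡ 1`. [this work] -/
theorem Cong1.one (d : ℕ) : Cong1 d (1 : (MvPowerSeries A ℚ)ˣ) := by
  simp [Cong1, VanLT]

/-- `Cong1 d` is closed under products. [this work] -/
theorem Cong1.mul {d : ℕ} {w w' : (MvPowerSeries A ℚ)ˣ} (hw : Cong1 d w) (hw' : Cong1 d w') : Cong1 d (w * w') := by
  have : ((w * w' : (MvPowerSeries A ℚ)ˣ) : MvPowerSeries A ℚ) - 1 = (w : MvPowerSeries A ℚ) * ((w' : MvPowerSeries A ℚ) - 1)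
      + ((w : MvPowerSeries A ℚ) - 1) := by
    rw [Units.val_mul]; ring
  unfold Cong1; rw [this]
  exact (hw'.mul_left _).add hw

/-- `Cong1 d` is closed under inverses. [this work] -/
theorem Cong1.inv {d : ℕ} {w : (MvPowerSeries A ℚ)ˣ} (hw : Cong1 d w) : Cong1 d w⁻¹ := by
  have : ((w⁻¹ : (MvPowerSeries A ℚ)ˣ) : MvPowerSeries A ℚ) - 1 =
      -(((w⁻¹ : (MvPowerSeries A ℚ)ˣ) : MvPowerSeries A ℚ) * ((w : MvPowerSeries A ℚ) - 1)) := by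
    rw [mul_sub, Units.inv_mul, mul_one]; ring
  unfold Cong1; rw [this]
  exact (hw.mul_left _).neg

/-- `Cong1 d` is closed under natural powers. [this work] -/
theorem Cong1.pow {d : ℕ} {w : (MvPowerSeries A ℚ)ˣ} (hw : Cong1 d w) (k : ℕ) : Cong1 d (w ^ k) := by
  induction k with
  | zero => rw [pow_zero]; exact Cong1.one d
  | succ k ih => rw [pow_succ]; exact ih.mul hw

/-- `Cong1 d` is closed under integer powers. [this work] -/
theorem Cong1.zpow {d : ℕ} {w : (MvPowerSeries A ℚ)ˣ} (hw : Cong1 d w) (e : ℤ) : Cong1 d (w ^ e) := by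
  obtain ⟨k, rfl | rfl⟩ := Int.eq_nat_or_neg e
  · rw [zpow_natCast]; exact hw.pow k
  · rw [zpow_neg, zpow_natCast]; exact (hw.pow k).inv

/-- `Cong1 d` is closed under finite products. [this work] -/
theorem Cong1.prod {d : ℕ} {ι : Type*} (s : Finset ι) (f : ι → (MvPowerSeries A ℚ)ˣ) (h : ∀ i ∈ s, Cong1 d (f i)) :
    Cong1 d (∏ i ∈ s, f i) := by
  classical
  induction s using Finset.induction_on with
  | empty => rw [prod_empty]; exact Cong1.one d
  | insert i s hi ih =>
    rw [prod_insert hi]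
    exact (h i (mem_insert_self i s)).mul (ih fun j hj => h j (mem_insert_of_mem hj))

variable {m : Finset A → MvPowerSeries A ℚ}

/-! ## FACT 2: Lazard elimination of one colour -/

/-- `g m C = (1 - m C)⁻¹ - 1 = m_C + m_C ^ 2 + ⋯`. [this work] -/
noncomputable def g (m : Finset A → MvPowerSeries A ℚ) (C : Finset A) : MvPowerSeries A ℚ :=
  (1 - m C)⁻¹ - 1

/-- Lazard elimination of the colour `C`: every old letter of colour `T ≠ C` followed by a NONEMPTY string of
colour-`C` letters becomes a new letter of colour `T ∪ C`; the letters of colour `C` themselves disappear. [this work] -/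
noncomputable def elim (m : Finset A → MvPowerSeries A ℚ) (C : Finset A) : Finset A → MvPowerSeries A ℚ :=
  fun S => (if S = C then 0 else m S) + g m C * ∑ T ∈ S.powerset with (T ≠ C ∧ T ∪ C = S), m T

omit [DecidableEq A] in
/-- `g m C` has no constant term. [this work] -/
theorem constantCoeff_g (hm : IsConfig m) (C : Finset A) : constantCoeff (g m C) = 0 := by
  rw [g, map_sub, constantCoeff_inv, map_sub, map_one, hm.const, sub_zero, inv_one, sub_self]

/-- `g m C` has nonnegative coefficients (geometric series). [this work] -/
theorem nonneg_g (hm : IsConfig m) (C : Finset A) : Nonneg (g m C) := by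
  intro n
  rw [g, map_sub, coeff_one]
  split_ifs with hn
  · subst hn
    rw [coeff_zero_eq_constantCoeff_apply, constantCoeff_inv, map_sub, map_one, hm.const]; norm_num
  · rw [sub_zero]
    exact nonneg_inv_one_sub (hm.const C) (hm.nonneg C) n

omit [DecidableEq A] in
/-- `1 + g m C = (1 - m C)⁻¹`. [this work] -/
theorem one_add_g (C : Finset A) : 1 + g m C = (1 - m C)⁻¹ := by
  rw [g]; ring

omit [DecidableEq A] in
/-- `(1 - m C)(1 - m C)⁻¹ = 1`. [this work] -/
theorem one_sub_mul_inv (hm : IsConfig m) (C : Finset A) : (1 - m C) * (1 - m C)⁻¹ = 1 :=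
  MvPowerSeries.mul_inv_cancel _ (by rw [map_sub, map_one, hm.const, sub_zero]; exact one_ne_zero)

/-- The eliminated configuration is a configuration. [this work] -/
theorem isConfig_elim (hm : IsConfig m) (C : Finset A) : IsConfig (elim m C) where
  empty := by
    have h1 : (if (∅ : Finset A) = C then (0 : MvPowerSeries A ℚ) else m ∅) = 0 := by
      split_ifs <;> simp [hm.empty]
    have h2 : ∑ T ∈ (∅ : Finset A).powerset with (T ≠ C ∧ T ∪ C = ∅), m T = 0 := by
      refine sum_eq_zero fun T hT => ?_
      simp only [powerset_empty, mem_filter, mem_singleton] at hT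
      rw [hT.1, hm.empty]
    simp only [elim, h1, h2, mul_zero, add_zero]
  const := fun S => by
    simp only [elim, map_add, map_mul, constantCoeff_g hm, zero_mul, add_zero]
    split_ifs <;> simp [hm.const]
  nonneg := fun S => by
    refine Nonneg.add ?_ (Nonneg.mul (nonneg_g hm C) (Nonneg.sum _ _ fun T _ => hm.nonneg T))
    split_ifs
    · exact nonneg_zero
    · exact hm.nonneg S

/-- FACT 2a: colours not containing `C` are untouched. [this work] -/
theorem y_elim_of_not_subset (C B : Finset A) (hCB : ¬ C ⊆ B) : y (elim m C) B = y m B := by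
  unfold y
  refine sum_congr rfl fun S hS => ?_
  have hSB : S ⊆ B := mem_powerset.mp hS
  have hSC : S ≠ C := fun h => hCB (h ▸ hSB)
  have hsum : ∑ T ∈ S.powerset with (T ≠ C ∧ T ∪ C = S), m T = 0 := by
    refine sum_eq_zero fun T hT => ?_
    exfalso
    simp only [mem_filter, mem_powerset] at hT
    exact hCB (subset_union_right.trans (hT.2.2.le.trans hSB))
  simp [elim, hSC, hsum]

/-- The inner double sum of the elimination: every `T ⊆ B`, `T ≠ C`, is counted once (at `S = T ∪ C`). [this work] -/
theorem sum_sum_elim (C B : Finset A) (hCB : C ⊆ B) :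
    ∑ S ∈ B.powerset, ∑ T ∈ S.powerset with (T ≠ C ∧ T ∪ C = S), m T = ∑ T ∈ B.powerset.erase C, m T := by
  rw [← sum_biUnion]
  · refine sum_congr ?_ fun _ _ => rfl
    ext T
    simp only [mem_biUnion, mem_powerset, mem_filter, mem_erase]
    constructor
    · rintro ⟨S, hSB, hTS, hTC, -⟩
      exact ⟨hTC, hTS.trans hSB⟩
    · rintro ⟨hTC, hTB⟩
      exact ⟨T ∪ C, union_subset hTB hCB, subset_union_left, hTC, rfl⟩
  · intro S _ S' _ hSS'
    simp only [Function.onFun]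
    rw [Finset.disjoint_left]
    intro T hT hT'
    simp only [mem_filter] at hT hT'
    exact hSS' (hT.2.2.symm.trans hT'.2.2)

/-- FACT 2b: for `B ⊇ C`, `y' B = (y B - m C)(1 - m C)⁻¹`. [this work] -/
theorem y_elim_of_subset (C B : Finset A) (hCB : C ⊆ B) :
    y (elim m C) B = (y m B - m C) * (1 - m C)⁻¹ := by
  have hC : C ∈ B.powerset := mem_powerset.mpr hCB
  have h1 : ∑ S ∈ B.powerset, (if S = C then (0 : MvPowerSeries A ℚ) else m S) = y m B - m C := by
    rw [y, ← sum_erase_eq_sub hC, ← sum_erase (B.powerset) (f := fun S => if S = C then (0 : MvPowerSeries A ℚ)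
      else m S) (a := C) (by simp)]
    exact sum_congr rfl fun S hS => by rw [if_neg (mem_erase.mp hS).1]
  have h2 : ∑ T ∈ B.powerset.erase C, m T = y m B - m C := by
    rw [y, sum_erase_eq_sub hC]
  calc y (elim m C) B
      = ∑ S ∈ B.powerset, (if S = C then (0 : MvPowerSeries A ℚ) else m S)
          + g m C * ∑ S ∈ B.powerset, ∑ T ∈ S.powerset with (T ≠ C ∧ T ∪ C = S), m T := by
        rw [y, mul_sum, ← sum_add_distrib]; rfl
    _ = (y m B - m C) + g m C * (y m B - m C) := by rw [h1, sum_sum_elim C B hCB, h2]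
    _ = (y m B - m C) * (1 + g m C) := by ring
    _ = (y m B - m C) * (1 - m C)⁻¹ := by rw [one_add_g]

/-- FACT 2b, unit form: `1 - y' B = (1 - y B)(1 - m C)⁻¹` for `B ⊇ C`. [this work] -/
theorem one_sub_y_elim_of_subset (hm : IsConfig m) (C B : Finset A) (hCB : C ⊆ B) :
    1 - y (elim m C) B = (1 - y m B) * (1 - m C)⁻¹ := by
  rw [y_elim_of_subset C B hCB]
  have := one_sub_mul_inv hm C
  calc 1 - (y m B - m C) * (1 - m C)⁻¹
      = (1 - m C) * (1 - m C)⁻¹ - (y m B - m C) * (1 - m C)⁻¹ := by rw [this]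
    _ = (1 - y m B) * (1 - m C)⁻¹ := by ring

/-- The unit `1 - m C`. [this work] -/
noncomputable def V (m : Finset A → MvPowerSeries A ℚ) (hm : IsConfig m) (C : Finset A) : (MvPowerSeries A ℚ)ˣ :=
  unitOf (1 - m C) (by rw [map_sub, map_one, hm.const, sub_zero])

/-- FACT 2a in the unit group: `U' B = U B` for `B ⊉ C`. [this work] -/
theorem U_elim_of_not_subset (hm : IsConfig m) (C B : Finset A) (hCB : ¬ C ⊆ B) :
    U (elim m C) (isConfig_elim hm C) B = U m hm B := by
  ext : 1
  simp only [val_U, y_elim_of_not_subset C B hCB]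

/-- FACT 2b in the unit group: `U' B = U B · V⁻¹` for `B ⊇ C`. [this work] -/
theorem U_elim_of_subset (hm : IsConfig m) (C B : Finset A) (hCB : C ⊆ B) :
    U (elim m C) (isConfig_elim hm C) B = U m hm B * (V m hm C)⁻¹ := by
  ext : 1
  rw [val_U, one_sub_y_elim_of_subset hm C B hCB, Units.val_mul, val_U]
  rfl

/-- FACT 2c: `T' S = T S · V ^ (-[S = C])`; in particular `T' S = T S` for `S ≠ C`. [this work] -/
theorem T_elim (hm : IsConfig m) (C S : Finset A) :
    T (elim m C) (isConfig_elim hm C) S = T m hm S * (V m hm C)⁻¹ ^ (if C = S then (1 : ℤ) else 0) := by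
  unfold T
  rw [← prod_filter_mul_prod_filter_not S.powerset (fun B => C ⊆ B),
    ← prod_filter_mul_prod_filter_not S.powerset (fun B => C ⊆ B) (f := fun B => U m hm B ^ sgn B S)]
  have h2 : ∏ B ∈ S.powerset with ¬ C ⊆ B, U (elim m C) (isConfig_elim hm C) B ^ sgn B S =
      ∏ B ∈ S.powerset with ¬ C ⊆ B, U m hm B ^ sgn B S :=
    prod_congr rfl fun B hB => by rw [U_elim_of_not_subset hm C B (mem_filter.mp hB).2]
  have h1 : ∏ B ∈ S.powerset with C ⊆ B, U (elim m C) (isConfig_elim hm C) B ^ sgn B S =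
      (∏ B ∈ S.powerset with C ⊆ B, U m hm B ^ sgn B S) * (V m hm C)⁻¹ ^ (if C = S then (1 : ℤ) else 0) := by
    by_cases hCS : C ⊆ S
    · rw [← sum_sgn_Icc_eq C S hCS, ← prod_zpow_eq_zpow_sum, ← prod_mul_distrib]
      exact prod_congr rfl fun B hB => by rw [U_elim_of_subset hm C B (mem_filter.mp hB).2, mul_zpow]
    · have hem : S.powerset.filter (fun B => C ⊆ B) = ∅ := by
        refine filter_eq_empty_iff.mpr fun B hB hCB => hCS (hCB.trans (mem_powerset.mp hB))
      have hne : C ≠ S := fun h => hCS h.le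
      simp [hem, hne]
  rw [h1, h2, mul_right_comm]

/-- FACT 2c: `T' S = T S` for `S ≠ C`. [this work] -/
theorem T_elim_of_ne (hm : IsConfig m) (C S : Finset A) (hS : C ≠ S) :
    T (elim m C) (isConfig_elim hm C) S = T m hm S := by
  rw [T_elim hm C S, if_neg hS, zpow_zero, mul_one]

/-- **FACT 2**: eliminating a colour OUTSIDE the family `𝒪` leaves `F m 𝒪` invariant. [this work] -/
theorem F_elim (hm : IsConfig m) (C : Finset A) (𝒪 : Finset (Finset A)) (hC𝒪 : C ∉ 𝒪) :
    F (elim m C) (isConfig_elim hm C) 𝒪 = F m hm 𝒪 :=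
  prod_congr rfl fun S hS => T_elim_of_ne hm C S (fun h => hC𝒪 (h ▸ hS))

end OpenProduct

end Summit.CriticalPhenomena.PercolationContinuityZ3.Theorems.SunflowerPartition
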